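import Summits.Ventures.LatticeQCDFlow.Scaling.StarAdditiveCertificate

/-!
HONEST FRAMING: exact (Metropolis-corrected) sampling algorithms for lattice gauge theory; figures
of merit are autocorrelation/cost numbers at stated couplings and volumes; no continuum-physics
claim.

# StarAdditiveDecay — THE DISTANCE-PROFILE FORM `d(n) ≤ (e·Ψ_max + 1)·e^{−hρn/4}` OF THE IDLE-LEVEL CHECKLIST (S2), OF THE LUMPED CHECKLIST (T5) AND OF THE
# ENVIRONMENT-FREE ADDITIVE CERTIFICATE (U1) (lean-2 GEN-34, ours)

Venture-side (OURS).  Cell `lqcd-flow` (pub-lqcd), unit `pub-lqcd-lean-2-g34`, 2026-08-29.  Chapter U, file 1b.  `StarSyncIdleBracket` (S2), `StarLumpedBracket` (T5) and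
`StarAdditiveCertificate` (U1) end in MIXING-TIME statements; the reduction of sector-exact flows to the label star (`SectorExactHubDominationLaw`,
`sectorExact_worstTvDist_le_labelStar_dom`) consumes the label star's DISTANCE PROFILE `d_L(n)`.  This file re-threads the same three checklists through
`starCycle_worstTvDist_le_of_supersolution` (S1) and `cyc_bound_le_exp` (R9): identical hypotheses (with `0 ≤ ρ`, `t ≤ 1`), conclusion
`d(n) ≤ (e·Ψ_max + 1)·exp(−((1−t)w_0·ρ/4)·n)`.  Proof bodies are those of S2 ∕ T5 ∕ U1 with the last line changed; hypothesis-equations throughout; no definitions.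

* `starCycle_worstTvDist_le_of_idle_supersolution` (S2 form), `homStar_worstTvDist_le_of_lumped_supersolution` (T5 form),
  **`homStar_worstTvDist_le_of_additiveCertificate`** (U1 form: `d(n) ≤ (e·K·G_max + 1)·exp(−((1−t)w_0·(σκ₀/K)/4)·n)`).

NOT CLAIMED: anything beyond U1; anything measured.  Literature grade (cell rule): OWN; nothing cited as a fact; no new bib keys.
-/

noncomputable section
open Finset Function
open Literature.Probability.MarkovChains

namespace Summit.Ventures.LatticeQCDFlow.Scaling

/-! ## §1 The idle-level checklist, distance form -/

section Idle
variable {K m : ℕ} {S : Type*} [Fintype S] [DecidableEq S] {μ : Fin (K + 1) → S → ℝ} {M : Fin (K + 1) → S → S → ℝ} {w : Fin (K + 1) → ℝ} {t : ℝ}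
variable (κ : Fin m → Fin K) (φ : Fin m → S ≃ S)

/-- **S2 in distance form:** the idle-level bracket checklist (`F ≥ 0`, bracket inequality, `R·F ≤ (1−ρ)Ψ`, `0 ≤ ρ ≤ 1`) gives
`d(n) ≤ (e·Ψ_max + 1)·exp(−((1−t)w_0·ρ/4)·n)`. [ours] -/
theorem starCycle_worstTvDist_le_of_idle_supersolution [Nonempty S] (hm : 1 ≤ m) (ht0 : 0 ≤ t) (ht1 : t ≤ 1) (hw0 : ∀ k, 0 ≤ w k)
    (hw1 : ∑ k, w k = 1) (hμ : ∀ k x, 0 < μ k x) (hμ1 : ∀ k, ∑ u, μ k u = 1) (hM : ∀ k, IsRowStochastic (M k))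
    (hMrev : ∀ k, DetailedBalance (μ k) (M k)) (hM0 : ∀ u v, M 0 u v = μ 0 v)
    (hidle : ∀ i : Fin K, ∀ u v, M i.succ u v = if v = u then 1 else 0)
    {α : Fin m → (Fin (K + 1) → S) → ℝ}
    (hα : ∀ r z, α r z = min 1 (tensorFun μ (edgeFlowSwap (φ r) 0 (κ r).succ z) / tensorFun μ z))
    {Q : (Fin (K + 1) → S) × (Fin (K + 1) → S) → (Fin (K + 1) → S) × (Fin (K + 1) → S) → ℝ}
    (hQ : ∀ a b, Q a b =
      ∑ r : Fin m, t / m *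
        (min (α r a.1) (α r a.2) * (if b.1 = edgeFlowSwap (φ r) 0 (κ r).succ a.1
              ∧ b.2 = edgeFlowSwap (φ r) 0 (κ r).succ a.2 then (1 : ℝ) else 0)
          + (α r a.1 - min (α r a.1) (α r a.2)) * (if b.1 = edgeFlowSwap (φ r) 0 (κ r).succ a.1 ∧ b.2 = a.2
              then (1 : ℝ) else 0)
          + (α r a.2 - min (α r a.1) (α r a.2)) * (if b.1 = a.1 ∧ b.2 = edgeFlowSwap (φ r) 0 (κ r).succ a.2
              then (1 : ℝ) else 0)
          + (1 - α r a.1 - α r a.2 + min (α r a.1) (α r a.2)) * (if b.1 = a.1 ∧ b.2 = a.2 then (1 : ℝ) else 0))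
      + (1 - t) * ∑ k : Fin (K + 1), w k *
        (if a.1 k = a.2 k ∨ k = 0 then
            ∑ v : S, M k (a.1 k) v * (if b.1 = update a.1 k v ∧ b.2 = update a.2 k v then (1 : ℝ) else 0)
          else coordKernel M k a.1 b.1 * coordKernel M k a.2 b.2))
    {R : (Fin (K + 1) → S) × (Fin (K + 1) → S) → (Fin (K + 1) → S) × (Fin (K + 1) → S) → ℝ}
    (hR : ∀ a b, R a b = ∑ v : S, μ 0 v * (if b.1 = update a.1 0 v ∧ b.2 = update a.2 0 v then (1 : ℝ) else 0))
    {M' : (Fin (K + 1) → S) × (Fin (K + 1) → S) → (Fin (K + 1) → S) × (Fin (K + 1) → S) → ℝ}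
    (hM' : ∀ a b, M' a b = Q a b - (1 - t) * w 0 * R a b)
    {ind : (Fin (K + 1) → S) × (Fin (K + 1) → S) → ℝ} (hind : ∀ a, ind a = if a.1 = a.2 then 0 else 1)
    {Ψ : (Fin (K + 1) → S) × (Fin (K + 1) → S) → ℝ} {Ψmax ρ : ℝ} (hΨ0 : ∀ a, 0 ≤ Ψ a) (hΨmax : ∀ a, Ψ a ≤ Ψmax)
    (hΨ1 : ∀ a : (Fin (K + 1) → S) × (Fin (K + 1) → S), (∃ i : Fin K, a.1 i.succ ≠ a.2 i.succ) → 1 ≤ Ψ a) (hρ0 : 0 ≤ ρ) (hρ1 : ρ ≤ 1)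
    {F : (Fin (K + 1) → S) × (Fin (K + 1) → S) → ℝ} (hF0 : ∀ a, 0 ≤ F a)
    (hbr : ∀ a : (Fin (K + 1) → S) × (Fin (K + 1) → S),
      (1 - t) * w 0 * Ψ a
        + ∑ r : Fin m, t / m *
          (min (α r a.1) (α r a.2) * F (edgeFlowSwap (φ r) 0 (κ r).succ a.1, edgeFlowSwap (φ r) 0 (κ r).succ a.2)
            + (α r a.1 - min (α r a.1) (α r a.2)) * F (edgeFlowSwap (φ r) 0 (κ r).succ a.1, a.2)
            + (α r a.2 - min (α r a.1) (α r a.2)) * F (a.1, edgeFlowSwap (φ r) 0 (κ r).succ a.2)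
            + (1 - α r a.1 - α r a.2 + min (α r a.1) (α r a.2)) * F (a.1, a.2))
      ≤ (t + (1 - t) * w 0) * F a)
    (hRF : ∀ a, (Matrix.mulVec (fun a b => R a b) F) a ≤ (1 - ρ) * Ψ a) (n : ℕ) :
    worstTvDist (fun y z : Fin (K + 1) → S =>
        t * ptGraphSwap μ (fun r : Fin m => (((0 : Fin (K + 1)), (κ r).succ) : Fin (K + 1) × Fin (K + 1))) φ y z
          + (1 - t) * prodKernel w M y z) (tensorFun μ) n
      ≤ (Real.exp 1 * Ψmax + 1) * Real.exp (-((1 - t) * w 0 * ρ / 4) * n) := by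
  have hw01 : w 0 ≤ 1 := by
    have := Finset.single_le_sum (f := w) (fun k _ => hw0 k) (mem_univ (0 : Fin (K + 1)))
    rw [hw1] at this; exact this
  have hh0 : 0 ≤ (1 - t) * w 0 := mul_nonneg (by linarith) (hw0 0)
  have hh1 : (1 - t) * w 0 ≤ 1 := by nlinarith [hw0 0]
  have hΨ : 0 ≤ Ψmax := (hΨ0 (Classical.arbitrary _)).trans (hΨmax _)
  have hx0 : 0 < 1 - ρ / 2 := by linarith
  have hx1 : 1 - ρ / 2 ≤ 1 := by linarith
  exact (starCycle_worstTvDist_le_of_supersolution κ φ hm ht0 ht1 hw0 hw1 hμ hμ1 hM hMrev hM0 hα hQ hR hM' hind hΨ0 hΨmax hΨ1 hρ1 hF0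
    (starSync_idle_supersolution_of κ φ hw1 hM0 hidle hQ hR hM' hbr) hRF n ⌊(n : ℝ) * ((1 - t) * w 0) / 4⌋₊ hx0 hx1).trans
    (cyc_bound_le_exp hh0 hh1 hρ0 hρ1 hΨ n)

end Idle

/-! ## §2 The lumped checklist, distance form -/

section Lumped
variable {K m : ℕ} {S : Type*} [Fintype S] [DecidableEq S] {μ : Fin (K + 1) → S → ℝ}
variable (κ : Fin m → Fin K)
variable {M : Fin (K + 1) → S → S → ℝ} {w : Fin (K + 1) → ℝ} {t : ℝ}
variable {cnt : (Fin (K + 1) → S) × (Fin (K + 1) → S) → S → S → ℝ}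

/-- **T5 in distance form:** the lumped checklist gives `d(n) ≤ (e·Ψ_max + 1)·exp(−((1−t)w_0·ρ/4)·n)`. [ours] -/
theorem homStar_worstTvDist_le_of_lumped_supersolution [Nonempty S] (hm : 1 ≤ m) (ht0 : 0 ≤ t) (ht1 : t ≤ 1) (hw0 : ∀ k, 0 ≤ w k)
    (hw1 : ∑ k, w k = 1) (hμ : ∀ k x, 0 < μ k x) (hμ1 : ∀ k, ∑ u, μ k u = 1) (hM0 : ∀ u v, M 0 u v = μ 0 v)
    (hidle : ∀ i : Fin K, ∀ u v, M i.succ u v = if v = u then 1 else 0) (hhom : ∀ i : Fin K, μ i.succ = μ 1)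
    {c : ℕ} (hunif : ∀ i : Fin K, (univ.filter fun r : Fin m => κ r = i).card = c)
    {acc : S → S → ℝ} (hacc : ∀ u v, acc u v = min 1 (μ 0 v * μ 1 u / (μ 0 u * μ 1 v)))
    (hcnt : ∀ a s t, cnt a s t = ((univ.filter fun i : Fin K => a.1 i.succ = s ∧ a.2 i.succ = t).card : ℝ))
    {Fl Ψl : S → S → (S → S → ℝ) → ℝ} {Ψmax ρ : ℝ} (hF0 : ∀ a : (Fin (K + 1) → S) × (Fin (K + 1) → S), 0 ≤ Fl (a.1 0) (a.2 0) (cnt a))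
    (hΨ0 : ∀ a : (Fin (K + 1) → S) × (Fin (K + 1) → S), 0 ≤ Ψl (a.1 0) (a.2 0) (cnt a))
    (hΨmax : ∀ a : (Fin (K + 1) → S) × (Fin (K + 1) → S), Ψl (a.1 0) (a.2 0) (cnt a) ≤ Ψmax)
    (hΨ1 : ∀ a : (Fin (K + 1) → S) × (Fin (K + 1) → S), (∃ i : Fin K, a.1 i.succ ≠ a.2 i.succ) → 1 ≤ Ψl (a.1 0) (a.2 0) (cnt a))
    (hρ0 : 0 ≤ ρ) (hρ1 : ρ ≤ 1)
    (hbr : ∀ a : (Fin (K + 1) → S) × (Fin (K + 1) → S),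
      (1 - t) * w 0 * Ψl (a.1 0) (a.2 0) (cnt a)
        + t / K * ∑ st : S × S, cnt a st.1 st.2 *
          (min (acc (a.1 0) st.1) (acc (a.2 0) st.2)
              * Fl st.1 st.2 (fun s t' => cnt a s t' - (if st.1 = s ∧ st.2 = t' then 1 else 0) + (if a.1 0 = s ∧ a.2 0 = t' then 1 else 0))
            + (acc (a.1 0) st.1 - min (acc (a.1 0) st.1) (acc (a.2 0) st.2))
              * Fl st.1 (a.2 0) (fun s t' => cnt a s t' - (if st.1 = s ∧ st.2 = t' then 1 else 0) + (if a.1 0 = s ∧ st.2 = t' then 1 else 0))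
            + (acc (a.2 0) st.2 - min (acc (a.1 0) st.1) (acc (a.2 0) st.2))
              * Fl (a.1 0) st.2 (fun s t' => cnt a s t' - (if st.1 = s ∧ st.2 = t' then 1 else 0) + (if st.1 = s ∧ a.2 0 = t' then 1 else 0))
            + (1 - acc (a.1 0) st.1 - acc (a.2 0) st.2 + min (acc (a.1 0) st.1) (acc (a.2 0) st.2)) * Fl (a.1 0) (a.2 0) (cnt a))
      ≤ (t + (1 - t) * w 0) * Fl (a.1 0) (a.2 0) (cnt a))
    (hRF : ∀ a : (Fin (K + 1) → S) × (Fin (K + 1) → S), ∑ v : S, μ 0 v * Fl v v (cnt a) ≤ (1 - ρ) * Ψl (a.1 0) (a.2 0) (cnt a))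
    (n : ℕ) :
    worstTvDist (fun y z : Fin (K + 1) → S =>
        t * ptGraphSwap μ (fun r : Fin m => (((0 : Fin (K + 1)), (κ r).succ) : Fin (K + 1) × Fin (K + 1))) (fun _ : Fin m => Equiv.refl S) y z
          + (1 - t) * prodKernel w M y z) (tensorFun μ) n
      ≤ (Real.exp 1 * Ψmax + 1) * Real.exp (-((1 - t) * w 0 * ρ / 4) * n) := by  -- the exact redraw at the hub and idle cold kernels are row-stochastic and reversible (as in S4, any content type)
  have hM : ∀ k, IsRowStochastic (M k) := fun k => by
    cases k using Fin.cases with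
    | zero => exact ⟨fun u v => by rw [hM0]; exact (hμ 0 v).le, fun u => by simp_rw [hM0]; exact hμ1 0⟩
    | succ i =>
      refine ⟨fun u v => by rw [hidle]; split_ifs <;> norm_num, fun u => ?_⟩
      simp_rw [hidle i]
      rw [Finset.sum_ite_eq' univ u, if_pos (mem_univ _)]
  have hMrev : ∀ k, DetailedBalance (μ k) (M k) := fun k => by
    intro u v
    cases k using Fin.cases with
    | zero => rw [hM0, hM0, mul_comm]
    | succ i =>
      rw [hidle, hidle]
      by_cases huv : u = v
      · subst huv; rfl
      · rw [if_neg (Ne.symm huv), if_neg huv, mul_zero, mul_zero]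
  -- the data of the synchronous coupling, instantiated by `rfl`
  let α : Fin m → (Fin (K + 1) → S) → ℝ := fun r z => min 1 (tensorFun μ (edgeFlowSwap (Equiv.refl S) 0 (κ r).succ z) / tensorFun μ z)
  have hα : ∀ r z, α r z = min 1 (tensorFun μ (edgeFlowSwap ((fun _ : Fin m => Equiv.refl S) r) 0 (κ r).succ z) / tensorFun μ z) := fun r z => rfl
  let R : (Fin (K + 1) → S) × (Fin (K + 1) → S) → (Fin (K + 1) → S) × (Fin (K + 1) → S) → ℝ := fun a b =>
      ∑ v : S, μ 0 v * (if b.1 = update a.1 0 v ∧ b.2 = update a.2 0 v then (1 : ℝ) else 0)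
  have hR : ∀ a b, R a b = ∑ v : S, μ 0 v * (if b.1 = update a.1 0 v ∧ b.2 = update a.2 0 v then (1 : ℝ) else 0) := fun a b => rfl
  let F : (Fin (K + 1) → S) × (Fin (K + 1) → S) → ℝ := fun a => Fl (a.1 0) (a.2 0) (cnt a)
  have hF : ∀ a, F a = Fl (a.1 0) (a.2 0) (cnt a) := fun a => rfl
  let Ψ : (Fin (K + 1) → S) × (Fin (K + 1) → S) → ℝ := fun a => Ψl (a.1 0) (a.2 0) (cnt a)
  refine starCycle_worstTvDist_le_of_idle_supersolution κ (fun _ : Fin m => Equiv.refl S) hm ht0 ht1 hw0 hw1 hμ hμ1 hM hMrev hM0 hidle hα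
    (Q := fun a b => ∑ r : Fin m, t / m *
        (min (α r a.1) (α r a.2) * (if b.1 = edgeFlowSwap (Equiv.refl S) 0 (κ r).succ a.1
              ∧ b.2 = edgeFlowSwap (Equiv.refl S) 0 (κ r).succ a.2 then (1 : ℝ) else 0)
          + (α r a.1 - min (α r a.1) (α r a.2)) * (if b.1 = edgeFlowSwap (Equiv.refl S) 0 (κ r).succ a.1 ∧ b.2 = a.2
              then (1 : ℝ) else 0)
          + (α r a.2 - min (α r a.1) (α r a.2)) * (if b.1 = a.1 ∧ b.2 = edgeFlowSwap (Equiv.refl S) 0 (κ r).succ a.2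
              then (1 : ℝ) else 0)
          + (1 - α r a.1 - α r a.2 + min (α r a.1) (α r a.2)) * (if b.1 = a.1 ∧ b.2 = a.2 then (1 : ℝ) else 0))
      + (1 - t) * ∑ k : Fin (K + 1), w k *
        (if a.1 k = a.2 k ∨ k = 0 then
            ∑ v : S, M k (a.1 k) v * (if b.1 = update a.1 k v ∧ b.2 = update a.2 k v then (1 : ℝ) else 0)
          else coordKernel M k a.1 b.1 * coordKernel M k a.2 b.2))
    (fun a b => rfl) (R := R) hR (M' := fun a b => _ ) (fun a b => rfl) (ind := fun a => if a.1 = a.2 then 0 else 1) (fun a => rfl)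
    (Ψ := Ψ) (Ψmax := Ψmax) (ρ := ρ) hΨ0 hΨmax hΨ1 hρ0 hρ1 (F := F) hF0 (fun a => ?_) (fun a => ?_) n
  · -- the bracket inequality, lumped
    have hb := homStar_lumped_bracket κ (t := t) hm hμ hhom hunif hα hacc hcnt hF a
    rw [hb]
    exact hbr a
  · rw [homStar_lumped_redraw hcnt hR hF a]
    exact hRF a

end Lumped

/-! ## §3 The additive certificate, distance form -/

section Additive
variable {K m : ℕ} {S : Type*} [Fintype S] [DecidableEq S] {μ : Fin (K + 1) → S → ℝ}
variable (κ : Fin m → Fin K)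
variable {M : Fin (K + 1) → S → S → ℝ} {w : Fin (K + 1) → ℝ} {t : ℝ}
variable {cnt : (Fin (K + 1) → S) × (Fin (K + 1) → S) → S → S → ℝ}

/-- **U1 in distance form:** the environment-free additive certificate ((N), (D), (R), `0 < κ₀ ≤ 1`) gives
`d(n) ≤ (e·(K·G_max) + 1)·exp(−((1−t)w_0·(σκ₀/K)/4)·n)`. [ours] -/
theorem homStar_worstTvDist_le_of_additiveCertificate [Nonempty S] (hm : 1 ≤ m) (ht0 : 0 < t) (ht1 : t < 1) (hw0 : ∀ k, 0 ≤ w k) (hw00 : 0 < w 0)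
    (hw1 : ∑ k, w k = 1) (hμ : ∀ k x, 0 < μ k x) (hμ1 : ∀ k, ∑ u, μ k u = 1) (hM0 : ∀ u v, M 0 u v = μ 0 v)
    (hidle : ∀ i : Fin K, ∀ u v, M i.succ u v = if v = u then 1 else 0) (hhom : ∀ i : Fin K, μ i.succ = μ 1)
    {c : ℕ} (hunif : ∀ i : Fin K, (univ.filter fun r : Fin m => κ r = i).card = c)
    {acc : S → S → ℝ} (hacc : ∀ u v, acc u v = min 1 (μ 0 v * μ 1 u / (μ 0 u * μ 1 v)))
    (hcnt : ∀ a s t, cnt a s t = ((univ.filter fun i : Fin K => a.1 i.succ = s ∧ a.2 i.succ = t).card : ℝ))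
    {G E : S → S → ℝ} {Gmax κ₀ σ : ℝ} (hG0d : ∀ s, G s s = 0) (hG1 : ∀ u v, u ≠ v → 1 ≤ G u v) (hG0 : ∀ u v, 0 ≤ G u v) (hGmax : ∀ u v, G u v ≤ Gmax)
    (hE0 : ∀ u v, 0 ≤ E u v) (hσ : σ = t / (t + (1 - t) * w 0))
    {net : S → S → S → ℝ}
    (hnet : ∀ z u v, net z u v = min (acc z u) (acc z v) * (G u v - σ * E u v)
      - (acc z u - min (acc z u) (acc z v)) * (G z v - G u v + σ * E u z) - (acc z v - min (acc z u) (acc z v)) * (G u z - G u v + σ * E z v))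
    (hN : ∀ z u v, 0 ≤ net z u v)
    (hD : ∀ a b s t, a ≠ b →
      min (acc a s) (acc b t) * (G a b - G s t + σ * E s t) + (acc a s - min (acc a s) (acc b t)) * (G a t - G s t + σ * E s b)
        + (acc b t - min (acc a s) (acc b t)) * (G s b - G s t + σ * E a t) + (1 - acc a s - acc b t + min (acc a s) (acc b t)) * (σ * E a b) ≤ E a b)
    (hR : ∀ u v, κ₀ * G u v ≤ ∑ z, μ 0 z * net z u v) (hκ0 : 0 < κ₀) (hκ1 : κ₀ ≤ 1)
    (n : ℕ) :
    worstTvDist (fun y z : Fin (K + 1) → S =>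
        t * ptGraphSwap μ (fun r : Fin m => (((0 : Fin (K + 1)), (κ r).succ) : Fin (K + 1) × Fin (K + 1))) (fun _ : Fin m => Equiv.refl S) y z
          + (1 - t) * prodKernel w M y z) (tensorFun μ) n
      ≤ (Real.exp 1 * (K * Gmax) + 1) * Real.exp (-((1 - t) * w 0 * (σ * κ₀ / K) / 4) * n) := by
  classical
  -- constants
  have hh0 : 0 < (1 - t) * w 0 := mul_pos (by linarith) hw00
  have hth : 0 < t + (1 - t) * w 0 := by linarith
  have hσ0 : 0 < σ := by rw [hσ]; exact div_pos ht0 hth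
  have hσ1 : σ ≤ 1 := by rw [hσ, div_le_one hth]; linarith
  have hσt : σ * (t + (1 - t) * w 0) = t := by rw [hσ]; field_simp
  have hK1 : 1 ≤ K := by
    rcases Nat.eq_zero_or_pos K with hK0 | hK0
    · exfalso; subst hK0
      have hmK := uniformList_card κ hunif
      simp only [CharP.cast_eq_zero, mul_zero, Nat.cast_eq_zero] at hmK; omega
    · exact hK0
  have hKpos : (0 : ℝ) < K := by exact_mod_cast hK1
  have hacc0 : ∀ u v, 0 ≤ acc u v := fun u v => by
    rw [hacc]; exact le_min zero_le_one (div_nonneg (mul_nonneg (hμ _ _).le (hμ _ _).le) (mul_nonneg (hμ _ _).le (hμ _ _).le))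
  have hacc1 : ∀ u v, acc u v ≤ 1 := fun u v => by rw [hacc]; exact min_le_left _ _
  have hNG : ∀ z u v, net z u v ≤ G u v := net_le_cost hacc0 hacc1 hG0 hE0 hσ0.le hnet
  -- the certificate pair, as hypothesis-equations
  let NET : S → (S → S → ℝ) → ℝ := fun z c => ∑ st : S × S, c st.1 st.2 * net z st.1 st.2
  have hNET : ∀ z c, NET z c = ∑ st : S × S, c st.1 st.2 * net z st.1 st.2 := fun z c => rfl
  let Ψl : (S → S → ℝ) → ℝ := fun c => ∑ st : S × S, c st.1 st.2 * G st.1 st.2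
  have hΨl : ∀ c, Ψl c = ∑ st : S × S, c st.1 st.2 * G st.1 st.2 := fun c => rfl
  let Fl : S → S → (S → S → ℝ) → ℝ := fun x y c => Ψl c + (if x = y then -(σ / K) * NET x c else σ * E x y)
  have hFl : ∀ x y c, Fl x y c = Ψl c + (if x = y then -(σ / K) * NET x c else σ * E x y) := fun x y c => rfl
  have hcnt0 : ∀ a s t, 0 ≤ cnt a s t := fun a s t => by rw [hcnt]; exact Nat.cast_nonneg _
  have hΨnn : ∀ a : (Fin (K + 1) → S) × (Fin (K + 1) → S), 0 ≤ Ψl (cnt a) := fun a =>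
    sum_nonneg fun st _ => mul_nonneg (hcnt0 a _ _) (hG0 _ _)
  refine homStar_worstTvDist_le_of_lumped_supersolution κ hm ht0.le ht1.le hw0 hw1 hμ hμ1 hM0 hidle hhom hunif hacc hcnt
    (Fl := Fl) (Ψl := fun _ _ c => Ψl c) (Ψmax := K * Gmax) (ρ := σ * κ₀ / K)
    (fun a => ?_) (fun a => hΨnn a) (fun a => ?_) (fun a hex => ?_) (by positivity) ?_ (fun a => ?_) (fun a => ?_) n
  · -- `F ≥ 0`
    show 0 ≤ Fl (a.1 0) (a.2 0) (cnt a)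
    rw [hFl]
    split_ifs with h
    · have h1 : NET (a.1 0) (cnt a) ≤ Ψl (cnt a) := addCert_NET_le hNG hNET hΨl (a.1 0) (hcnt0 a)
      have h2 : σ / K ≤ 1 := by rw [div_le_one hKpos]; exact hσ1.trans (by exact_mod_cast hK1)
      have h3 : 0 ≤ σ / K := div_nonneg hσ0.le hKpos.le
      nlinarith [hΨnn a, addCert_NET_nonneg hN hNET (a.1 0) (hcnt0 a)]
    · nlinarith [hΨnn a, hE0 (a.1 0) (a.2 0), hσ0]
  · -- `Ψ ≤ K·G_max`
    show Ψl (cnt a) ≤ K * Gmax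
    calc Ψl (cnt a) = ∑ st : S × S, cnt a st.1 st.2 * G st.1 st.2 := rfl
      _ ≤ ∑ st : S × S, cnt a st.1 st.2 * Gmax := sum_le_sum fun st _ => mul_le_mul_of_nonneg_left (hGmax _ _) (hcnt0 a _ _)
      _ = K * Gmax := by rw [← Finset.sum_mul]; rw [homStar_cnt_sum hcnt a]
  · -- `Ψ ≥ 1` where a cold level differs
    obtain ⟨i, hi⟩ := hex
    show 1 ≤ Ψl (cnt a)
    have hmem : (1 : ℝ) ≤ cnt a (a.1 i.succ) (a.2 i.succ) := by
      rw [hcnt]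
      have : 1 ≤ (univ.filter fun j : Fin K => a.1 j.succ = a.1 i.succ ∧ a.2 j.succ = a.2 i.succ).card :=
        Finset.card_pos.mpr ⟨i, by simp⟩
      exact_mod_cast this
    calc (1 : ℝ) ≤ cnt a (a.1 i.succ) (a.2 i.succ) * G (a.1 i.succ) (a.2 i.succ) := by nlinarith [hG1 _ _ hi]
      _ ≤ Ψl (cnt a) := by
        rw [hΨl]
        exact Finset.single_le_sum (f := fun st : S × S => cnt a st.1 st.2 * G st.1 st.2)
          (fun st _ => mul_nonneg (hcnt0 a _ _) (hG0 _ _)) (mem_univ (a.1 i.succ, a.2 i.succ))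
  · -- `ρ ≤ 1`
    rw [div_le_one hKpos]
    calc σ * κ₀ ≤ 1 * 1 := mul_le_mul hσ1 hκ1 hκ0.le zero_le_one
      _ ≤ K := by rw [one_mul]; exact_mod_cast hK1
  · -- the lumped bracket inequality
    have hsumK := homStar_cnt_sum hcnt a
    by_cases hab : a.1 0 = a.2 0
    · -- agreeing hub `z`
      have hz : a.2 0 = a.1 0 := hab.symm
      have hterm : ∀ st : S × S, cnt a st.1 st.2 *
          (min (acc (a.1 0) st.1) (acc (a.2 0) st.2)
              * Fl st.1 st.2 (fun s t' => cnt a s t' - (if st.1 = s ∧ st.2 = t' then 1 else 0) + (if a.1 0 = s ∧ a.2 0 = t' then 1 else 0))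
            + (acc (a.1 0) st.1 - min (acc (a.1 0) st.1) (acc (a.2 0) st.2))
              * Fl st.1 (a.2 0) (fun s t' => cnt a s t' - (if st.1 = s ∧ st.2 = t' then 1 else 0) + (if a.1 0 = s ∧ st.2 = t' then 1 else 0))
            + (acc (a.2 0) st.2 - min (acc (a.1 0) st.1) (acc (a.2 0) st.2))
              * Fl (a.1 0) st.2 (fun s t' => cnt a s t' - (if st.1 = s ∧ st.2 = t' then 1 else 0) + (if st.1 = s ∧ a.2 0 = t' then 1 else 0))
            + (1 - acc (a.1 0) st.1 - acc (a.2 0) st.2 + min (acc (a.1 0) st.1) (acc (a.2 0) st.2)) * Fl (a.1 0) (a.2 0) (cnt a))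
          ≤ cnt a st.1 st.2 * (Ψl (cnt a) - net (a.1 0) st.1 st.2) := by
        intro st
        rcases homStar_cnt_dichotomy hcnt a st.1 st.2 with h0 | h1
        · rw [h0, zero_mul, zero_mul]
        · refine mul_le_mul_of_nonneg_left ?_ (hcnt0 a _ _)
          rw [hz]
          exact addCert_bracket_agree_le (K := K) hacc0 hacc1 hG0d hE0 hσ0.le hnet hN hNET hΨl hFl (hcnt0 a) (a.1 0) h1
      have hsum := sum_le_sum fun st (_ : st ∈ (univ : Finset (S × S))) => hterm st
      have hsplit : ∑ st : S × S, cnt a st.1 st.2 * (Ψl (cnt a) - net (a.1 0) st.1 st.2) = K * Ψl (cnt a) - NET (a.1 0) (cnt a) := by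
        simp_rw [mul_sub]
        rw [Finset.sum_sub_distrib, ← Finset.sum_mul, hsumK]
      rw [hsplit] at hsum
      have hF : Fl (a.1 0) (a.2 0) (cnt a) = Ψl (cnt a) - σ / K * NET (a.1 0) (cnt a) := by rw [hFl, if_pos hab]; ring
      have htK : 0 ≤ t / K := div_nonneg ht0.le hKpos.le
      have key : t / K * (K * Ψl (cnt a) - NET (a.1 0) (cnt a)) = t * Ψl (cnt a) - t / K * NET (a.1 0) (cnt a) := by
        field_simp
      have hrhs : (t + (1 - t) * w 0) * Fl (a.1 0) (a.2 0) (cnt a) = (t + (1 - t) * w 0) * Ψl (cnt a) - t / K * NET (a.1 0) (cnt a) := by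
        rw [hF, mul_sub, show (t + (1 - t) * w 0) * (σ / K * NET (a.1 0) (cnt a)) = σ * (t + (1 - t) * w 0) / K * NET (a.1 0) (cnt a) by ring, hσt]
      rw [hrhs]
      nlinarith [mul_le_mul_of_nonneg_left hsum htK, key]
    · -- disagreeing hub `(a,b)`
      have hterm : ∀ st : S × S, cnt a st.1 st.2 *
          (min (acc (a.1 0) st.1) (acc (a.2 0) st.2)
              * Fl st.1 st.2 (fun s t' => cnt a s t' - (if st.1 = s ∧ st.2 = t' then 1 else 0) + (if a.1 0 = s ∧ a.2 0 = t' then 1 else 0))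
            + (acc (a.1 0) st.1 - min (acc (a.1 0) st.1) (acc (a.2 0) st.2))
              * Fl st.1 (a.2 0) (fun s t' => cnt a s t' - (if st.1 = s ∧ st.2 = t' then 1 else 0) + (if a.1 0 = s ∧ st.2 = t' then 1 else 0))
            + (acc (a.2 0) st.2 - min (acc (a.1 0) st.1) (acc (a.2 0) st.2))
              * Fl (a.1 0) st.2 (fun s t' => cnt a s t' - (if st.1 = s ∧ st.2 = t' then 1 else 0) + (if st.1 = s ∧ a.2 0 = t' then 1 else 0))
            + (1 - acc (a.1 0) st.1 - acc (a.2 0) st.2 + min (acc (a.1 0) st.1) (acc (a.2 0) st.2)) * Fl (a.1 0) (a.2 0) (cnt a))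
          ≤ cnt a st.1 st.2 * (Ψl (cnt a) + E (a.1 0) (a.2 0)) := by
        intro st
        rcases homStar_cnt_dichotomy hcnt a st.1 st.2 with h0 | h1
        · rw [h0, zero_mul, zero_mul]
        · refine mul_le_mul_of_nonneg_left ?_ (hcnt0 a _ _)
          exact addCert_bracket_disagree_le (K := K) hacc0 hacc1 hE0 hσ0.le hN hNET hΨl hFl hD (hcnt0 a) hab h1
      have hsum := sum_le_sum fun st (_ : st ∈ (univ : Finset (S × S))) => hterm st
      rw [← Finset.sum_mul, hsumK] at hsum
      have hF : Fl (a.1 0) (a.2 0) (cnt a) = Ψl (cnt a) + σ * E (a.1 0) (a.2 0) := by rw [hFl, if_neg hab]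
      have htK : 0 ≤ t / K := div_nonneg ht0.le hKpos.le
      have key : t / K * (K * (Ψl (cnt a) + E (a.1 0) (a.2 0))) = t * Ψl (cnt a) + t * E (a.1 0) (a.2 0) := by field_simp
      have hrhs : (t + (1 - t) * w 0) * Fl (a.1 0) (a.2 0) (cnt a) = (t + (1 - t) * w 0) * Ψl (cnt a) + t * E (a.1 0) (a.2 0) := by
        rw [hF, mul_add, show (t + (1 - t) * w 0) * (σ * E (a.1 0) (a.2 0)) = σ * (t + (1 - t) * w 0) * E (a.1 0) (a.2 0) by ring, hσt]
      rw [hrhs]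
      nlinarith [mul_le_mul_of_nonneg_left hsum htK, key]
  · -- the lumped redraw inequality
    show ∑ v, μ 0 v * Fl v v (cnt a) ≤ (1 - σ * κ₀ / K) * Ψl (cnt a)
    have hFv : ∀ v, Fl v v (cnt a) = Ψl (cnt a) - σ / K * NET v (cnt a) := fun v => by rw [hFl, if_pos rfl]; ring
    simp_rw [hFv, mul_sub]
    rw [Finset.sum_sub_distrib, ← Finset.sum_mul, hμ1 0, one_mul]
    -- `Σ_v μ_0(v)·NET(v;c) = Σ_{(s,t)} c(s,t)·Σ_v μ_0(v)·net(v;s,t) ≥ κ₀·Ψ`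
    have hex : ∑ v, μ 0 v * (σ / K * NET v (cnt a)) = σ / K * ∑ st : S × S, cnt a st.1 st.2 * ∑ v, μ 0 v * net v st.1 st.2 := by
      simp_rw [hNET, Finset.mul_sum]
      rw [Finset.sum_comm]
      refine sum_congr rfl fun st _ => ?_
      exact sum_congr rfl fun v _ => by ring
    rw [hex]
    have hlow : κ₀ * Ψl (cnt a) ≤ ∑ st : S × S, cnt a st.1 st.2 * ∑ v, μ 0 v * net v st.1 st.2 := by
      rw [hΨl, Finset.mul_sum]
      refine sum_le_sum fun st _ => ?_
      have := mul_le_mul_of_nonneg_left (hR st.1 st.2) (hcnt0 a st.1 st.2)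
      linarith [this]
    have h3 : 0 ≤ σ / K := div_nonneg hσ0.le hKpos.le
    have : σ * κ₀ / K * Ψl (cnt a) = σ / K * (κ₀ * Ψl (cnt a)) := by ring
    nlinarith [mul_le_mul_of_nonneg_left hlow h3, this]


end Additive

end Summit.Ventures.LatticeQCDFlow.Scaling

end
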